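import Summits.HubbardSuperconductivity.HubbardSuperconductivity.Theorems.AposterioriCapRgSeededBrokenRegimeBoseFermiPinnedChargeSeedCovariance

/-!
# Crux `SeededBrokenRegimeBoseFermiPinned` (stmt-HubbardSuperconductivity-14047), line `seed-strength-flow`:
# `U(1)` invariance at zero seed and charge neutrality of the kernels (stub `stub_chargeNeutrality`, S10b)

Support file (`--supports stmt-HubbardSuperconductivity-14047`).  Without pair seed the free covariance of the
Hubbard torus in any frame `K` is CHARGE CONSERVING: its Nambu propagator is diagonal at `h = 0`, so every
non-vanishing entry `C^{K,>Λ}_0(X, Y)` pairs a `ψ⁺` with a `ψ⁻`, and the rescaled covariance of the charge scaling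
`ψ⁺ ↦ zψ⁺`, `ψ⁻ ↦ z⁻¹ψ⁻` of `stub_chargeSeedCovariance` (S9) is the covariance itself
(`hubbardCovAboveCT_zero_seed_chargeScale`).  Hence the seedless countertermed effective action is `U(1)`-INVARIANT,
`S_z 𝒢^K_Λ(0) = 𝒢^K_Λ(0)` for every `z ≠ 0` (`map_chargeScale_hubbardEffectiveActionCT_zero_seed`; BGM 2006 §2.1,
symmetry (2), passed to the effective action), and by the selection rule of `GrassmannChargeScaling.lean`
(`kernel_eq_zero_of_invariant` with `z = 2`) every kernel of `𝒢^K_Λ(0)` with unequal numbers of `ψ⁺` and `ψ⁻` legs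
VANISHES: no anomalous vertex of any degree is generated at `h = 0`, in any frame, at any scale, for all finite
`L, M, β` — the charge-neutrality half of the Ward identity the seeded flow starts from.
-/

set_option linter.dupNamespace false -- `Summit.<S>.<S>` doubles the summit name (tree convention)

namespace Summit.HubbardSuperconductivity.HubbardSuperconductivity.Theorems.AposterioriCapRgSeededBrokenRegimeBoseFermiPinned

open Literature.MathematicalPhysics.QuantumLattice Literature.Probability.LatticeModels GrassmannAlgebra

variable {L M : ℕ}

/-- **At zero seed the free two-point table is charge conserving**: rescaling `ψ⁺` by `z⁻¹` and `ψ⁻` by `z` leaves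
`⟨ψ_Xψ_Y⟩^K_0` unchanged (the seedless Nambu propagator is diagonal; a normal pair carries reciprocal weights).
[folklore] -/
theorem hubbardTwoPointCT_zero_seed_chargeScale [NeZero L] (z : ℂ) (hz : z ≠ 0) (β μ : ℝ) (K : TrigPolyC4v)
    (X Y : HubbardFieldIdx L M) :
    (if X.2 = 0 then z⁻¹ else z) * (if Y.2 = 0 then z⁻¹ else z) * hubbardTwoPointCT L M β μ 0 K X Y =
      hubbardTwoPointCT L M β μ 0 K X Y := by
  obtain ⟨⟨k, σ⟩, q⟩ := X
  obtain ⟨⟨k', σ'⟩, q'⟩ := Y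
  simp only [hubbardTwoPointCT]
  fin_cases σ <;> fin_cases q <;> fin_cases σ' <;> fin_cases q' <;>
    simp [toNambu, nambuTwoPointCT, nambuPropagatorCT, Fin.rev, hz]

/-- **At zero seed the covariance above scale `Λ` is charge conserving**: the rescaled covariance of the charge
scaling by `z` (S9) is the covariance itself. [folklore] -/
theorem hubbardCovAboveCT_zero_seed_chargeScale [NeZero L] (z : ℂ) (hz : z ≠ 0) (β μ : ℝ) (K : TrigPolyC4v)
    (Λ : ℝ) (X Y : HubbardFieldIdx L M) :
    (if X.2 = 0 then z⁻¹ else z) * (if Y.2 = 0 then z⁻¹ else z) * hubbardCovAboveCT L M β μ 0 K Λ X Y =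
      hubbardCovAboveCT L M β μ 0 K Λ X Y := by
  simp only [hubbardCovAboveCT, hubbardCovarianceCT, Matrix.of_apply]
  conv_rhs => rw [← hubbardTwoPointCT_zero_seed_chargeScale z hz β μ K X Y]
  ring

variable (L M) [NeZero L]

/-- **The seedless countertermed effective action is `U(1)`-invariant**: `S_z 𝒢^K_Λ(0) = 𝒢^K_Λ(0)` for every
`z ≠ 0` (`ψ⁺ ↦ zψ⁺`, `ψ⁻ ↦ z⁻¹ψ⁻`), every `L ≥ 1`, `M`, `β`, `U`, `μ`, frame `K` and scale `Λ` — the instance `h = 0`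
of the `U(1)` × seed covariance S9. [cite: BenfattoGiulianiMastropietro2006, §2.1 (symmetry (2))] -/
theorem map_chargeScale_hubbardEffectiveActionCT_zero_seed {z : ℂ} (hz : z ≠ 0) (β U μ : ℝ) (K : TrigPolyC4v)
    (Λ : ℝ) :
    ExteriorAlgebra.map (LinearMap.mulLeft ℂ (fun X : HubbardFieldIdx L M => if X.2 = 0 then z else z⁻¹))
        (hubbardEffectiveActionCT L M β U μ 0 K Λ) = hubbardEffectiveActionCT L M β U μ 0 K Λ := by
  rw [stub_chargeSeedCovariance L M β U μ 0 K Λ z hz, hubbardEffectiveActionCT_def]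
  congr 1
  ext X Y
  rw [Matrix.of_apply, hubbardCovAboveCT_zero_seed_chargeScale z hz]

variable {L M}

omit [NeZero L] in
/-- In `Fin 2`, "not the `ψ⁺` charge index" is "the `ψ⁻` charge index". [folklore] -/
theorem filter_charge_ne_zero_eq {m : ℕ} (X : Fin m → HubbardFieldIdx L M) :
    (Finset.univ.filter fun i => ¬ (X i).2 = 0) = Finset.univ.filter fun i => (X i).2 = 1 := by
  refine Finset.filter_congr fun i _ => ?_
  generalize (X i).2 = q
  fin_cases q <;> simp

omit [NeZero L] in
/-- The total weight `2^{#ψ⁺} · 2^{-#ψ⁻}` of a label string under the scaling `w(ψ⁺) = 2`, `w(ψ⁻) = 2⁻¹` is `1`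
only if the string has as many `ψ⁺` as `ψ⁻` legs. [folklore] -/
theorem card_eq_of_prod_chargeWeight_two_eq_one {m : ℕ} (X : Fin m → HubbardFieldIdx L M)
    (h : ∏ i, (if (X i).2 = 0 then (2 : ℂ) else 2⁻¹) = 1) :
    (Finset.univ.filter fun i => (X i).2 = 0).card = (Finset.univ.filter fun i => (X i).2 = 1).card := by
  rw [Finset.prod_ite, Finset.prod_const, Finset.prod_const, filter_charge_ne_zero_eq] at h
  set a := (Finset.univ.filter fun i => (X i).2 = 0).card
  set b := (Finset.univ.filter fun i => (X i).2 = 1).card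
  have h2 : (2 : ℂ) ^ a = 2 ^ b := by
    have := congrArg (· * (2 : ℂ) ^ b) h
    simpa [mul_assoc, ← mul_pow] using this
  have h3 : ((2 ^ a : ℕ) : ℂ) = ((2 ^ b : ℕ) : ℂ) := by push_cast; exact h2
  exact Nat.pow_right_injective le_rfl (Nat.cast_injective h3)

/-- **S10b (`ChargeNeutrality`)**: at zero seed every kernel of the countertermed effective action with unequal
numbers of `ψ⁺` legs (charge index `0`) and `ψ⁻` legs (charge index `1`) vanishes — no anomalous vertex of any degree
is generated at `h = 0`, in any frame `K`, at any scale `Λ`, for all `L ≥ 1`, `M`, `β`, `U`, `μ` (the `U(1)` selection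
rule `kernel_eq_zero_of_invariant` applied to the `U(1)`-invariant `𝒢^K_Λ(0)` with the scaling `w(ψ^±) = 2^{±1}`).
[folklore] -/
theorem stub_chargeNeutrality :
    ∀ (L M : ℕ) [NeZero L] (β U μ : ℝ) (K : TrigPolyC4v) (Λ : ℝ) (m : ℕ) (X : Fin m → HubbardFieldIdx L M),
      (Finset.univ.filter fun i => (X i).2 = 0).card ≠ (Finset.univ.filter fun i => (X i).2 = 1).card →
        kernel ℂ (hubbardEffectiveActionCT L M β U μ 0 K Λ) m X = 0 := by
  intro L M _ β U μ K Λ m X hne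
  refine kernel_eq_zero_of_invariant ℂ (fun Y : HubbardFieldIdx L M => if Y.2 = 0 then (2 : ℂ) else 2⁻¹)
    (map_chargeScale_hubbardEffectiveActionCT_zero_seed L M two_ne_zero β U μ K Λ) ?_
  intro h
  exact hne (card_eq_of_prod_chargeWeight_two_eq_one X h)

end Summit.HubbardSuperconductivity.HubbardSuperconductivity.Theorems.AposterioriCapRgSeededBrokenRegimeBoseFermiPinned
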